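import Mathlib
import Summits.Ventures.PercRepro2.HCov
import Summits.Ventures.PercRepro2.GcTransport

/-!
# The root-pair edge scales the covariance form: `Gc(p) = (1 − p e)³ · Gc(p[e ↦ 0])` for
`e = {a₁, a₂}` (blind cell PercRepro2, typer-1 g56)

Every mass of `Gc` but the labelling gap is an event inside `Q = {a₁ ↮ a₂}`, and with the edge
`e = {a₁, a₂}` forced open `a₁ ↔ a₂`: by the pinning identity
`P_p(A) = p_e P_{p[e↦1]}(A) + (1 − p_e) P_{p[e↦0]}(A)` each such mass is `(1 − p_e)` times its
value at `p[e ↦ 0]`. The gap `P(a₂ ↔ b) − P(a₁ ↔ b)` is not `Q`-restricted, but with `e` forced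
open the two events coincide (`a₁ ↔ a₂`), so the gap scales by `(1 − p_e)` as well. `Gc` is
homogeneous of degree three in the masses, hence

  **`Gc_rootPair`**: `Gc p = (1 − p e)³ · Gc (p[e ↦ 0])`,

and **`HCov_of_update_zero_of_rootPair`** / **`HCov_of_loop_of_rootPair`**: (HCOV) with the
root-pair edge deleted (re-routed to a loop, `Gc_update_zero_eq_loop`) gives (HCOV) on `G` — the
root-pair edge is one more REDUCTION of the weighted calculus, lowering `nonLoopCard`. (The typed
lane excluded the typed root pair from its residual from the start; on the weighted side the
edge was thought not to scale `Gc` because of the gap — it does.) Standard axioms.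
-/

namespace Summit.Ventures.PercRepro2

open CovForm RECM

namespace RootPair

section Scale

variable {V : Type*} {E : Type*} [Fintype E] [DecidableEq E] {R : Type*} [Field R]

omit [Fintype E] [Field R] in
/-- With `e = {a₁, a₂}` forced open, `a₁ ↔ a₂`. -/
lemma conn_roots_update_true {ends : E → Sym2 V} {e : E} {a₁ a₂ : V} (he : ends e = s(a₁, a₂))
    (ω : Config E) : Conn ends (Function.update ω e true) a₁ a₂ :=
  conn_ends_of_open he (by simp)

/-- An event on which `a₁ ↮ a₂` is null with `e = {a₁, a₂}` forced open. -/
lemma prob_update_one_eq_zero_of_notConn (p : E → R) {ends : E → Sym2 V} {e : E} {a₁ a₂ : V}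
    (he : ends e = s(a₁, a₂)) {A : Set (Config E)} (hA : ∀ ω ∈ A, ¬ Conn ends ω a₁ a₂) :
    prob (Function.update p e 1) A = 0 := by
  rw [prob_update_one_eq_preimage]
  have h : (fun ω => Function.update ω e true) ⁻¹' A = ∅ := by
    ext ω
    simp only [Set.mem_preimage, Set.mem_empty_iff_false, iff_false]
    intro hω
    exact hA _ hω (conn_roots_update_true he ω)
  rw [h, prob_empty]

/-- **The scaling of a `Q`-restricted mass**: `P_p(A) = (1 − p e) P_{p[e↦0]}(A)` for
`A ⊆ {a₁ ↮ a₂}` and `e = {a₁, a₂}`. -/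
lemma prob_eq_of_notConn_roots (p : E → R) {ends : E → Sym2 V} {e : E} {a₁ a₂ : V}
    (he : ends e = s(a₁, a₂)) {A : Set (Config E)} (hA : ∀ ω ∈ A, ¬ Conn ends ω a₁ a₂) :
    prob p A = (1 - p e) * prob (Function.update p e 0) A := by
  rw [prob_eq_pin p A e, prob_update_one_eq_zero_of_notConn p he hA, mul_zero, zero_add]

omit [Fintype E] [DecidableEq E] [Field R] in
/-- On `Q = avoidAll ends a₂ {a₁}`, `a₁ ↮ a₂`. -/
lemma notConn_of_mem_Q {ends : E → Sym2 V} {a₁ a₂ : V} {ω : Config E}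
    (h : ω ∈ avoidAll ends a₂ {a₁}) : ¬ Conn ends ω a₁ a₂ := fun hc =>
  h a₁ (Finset.mem_singleton_self a₁) (conn_symm hc)

omit [Fintype E] [DecidableEq E] [Field R] in
/-- On `PD`, `a₁ ↮ a₂`. -/
lemma notConn_of_mem_PD {ends : E → Sym2 V} {a₁ a₂ a₃ : V} {ω : Config E}
    (h : ω ∈ PDEvent ends a₁ a₂ a₃) : ¬ Conn ends ω a₁ a₂ := h.1

omit [Fintype E] [DecidableEq E] [Field R] in
/-- On `T = TEvent ends a₁ a₂ a₃`, `a₁ ↮ a₂`. -/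
lemma notConn_of_mem_T {ends : E → Sym2 V} {a₁ a₂ a₃ : V} {ω : Config E}
    (h : ω ∈ TEvent ends a₁ a₂ a₃) : ¬ Conn ends ω a₁ a₂ := fun hc => h.1 (conn_symm hc)

omit [Fintype E] [DecidableEq E] [Field R] in
/-- On `T′ = TEvent ends a₂ a₁ a₃`, `a₁ ↮ a₂`. -/
lemma notConn_of_mem_T' {ends : E → Sym2 V} {a₁ a₂ a₃ : V} {ω : Config E}
    (h : ω ∈ TEvent ends a₂ a₁ a₃) : ¬ Conn ends ω a₁ a₂ := h.1

variable (p : E → R) {ends : E → Sym2 V} {e : E} {a₁ a₂ : V} (he : ends e = s(a₁, a₂))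
include he

/-- `Q ∩ X` scales. -/
lemma prob_Q_inter_rootPair (X : Set (Config E)) :
    prob p (avoidAll ends a₂ {a₁} ∩ X) =
      (1 - p e) * prob (Function.update p e 0) (avoidAll ends a₂ {a₁} ∩ X) :=
  prob_eq_of_notConn_roots p he fun _ hω => notConn_of_mem_Q hω.1

/-- `Q` scales. -/
lemma prob_Q_rootPair :
    prob p (avoidAll ends a₂ {a₁}) =
      (1 - p e) * prob (Function.update p e 0) (avoidAll ends a₂ {a₁}) :=
  prob_eq_of_notConn_roots p he fun _ hω => notConn_of_mem_Q hω

/-- `PD ∩ X` scales. -/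
lemma prob_PD_inter_rootPair (a₃ : V) (X : Set (Config E)) :
    prob p (PDEvent ends a₁ a₂ a₃ ∩ X) =
      (1 - p e) * prob (Function.update p e 0) (PDEvent ends a₁ a₂ a₃ ∩ X) :=
  prob_eq_of_notConn_roots p he fun _ hω => notConn_of_mem_PD hω.1

/-- `PD` scales. -/
lemma prob_PD_rootPair (a₃ : V) :
    prob p (PDEvent ends a₁ a₂ a₃) =
      (1 - p e) * prob (Function.update p e 0) (PDEvent ends a₁ a₂ a₃) :=
  prob_eq_of_notConn_roots p he fun _ hω => notConn_of_mem_PD hω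

/-- `T ∩ X` scales. -/
lemma prob_T_inter_rootPair (a₃ : V) (X : Set (Config E)) :
    prob p (TEvent ends a₁ a₂ a₃ ∩ X) =
      (1 - p e) * prob (Function.update p e 0) (TEvent ends a₁ a₂ a₃ ∩ X) :=
  prob_eq_of_notConn_roots p he fun _ hω => notConn_of_mem_T hω.1

/-- `T` scales. -/
lemma prob_T_rootPair (a₃ : V) :
    prob p (TEvent ends a₁ a₂ a₃) =
      (1 - p e) * prob (Function.update p e 0) (TEvent ends a₁ a₂ a₃) :=
  prob_eq_of_notConn_roots p he fun _ hω => notConn_of_mem_T hω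

/-- `T′ ∩ X` scales. -/
lemma prob_T'_inter_rootPair (a₃ : V) (X : Set (Config E)) :
    prob p (TEvent ends a₂ a₁ a₃ ∩ X) =
      (1 - p e) * prob (Function.update p e 0) (TEvent ends a₂ a₁ a₃ ∩ X) :=
  prob_eq_of_notConn_roots p he fun _ hω => notConn_of_mem_T' hω.1

/-- `T′` scales. -/
lemma prob_T'_rootPair (a₃ : V) :
    prob p (TEvent ends a₂ a₁ a₃) =
      (1 - p e) * prob (Function.update p e 0) (TEvent ends a₂ a₁ a₃) :=
  prob_eq_of_notConn_roots p he fun _ hω => notConn_of_mem_T' hω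

/-- **The gap scales**: with `e` forced open `a₁ ↔ a₂`, so `{a₂ ↔ b}` and `{a₁ ↔ b}` coincide
there. -/
lemma gap_rootPair (b : V) :
    gap p ends a₁ a₂ b = (1 - p e) * gap (Function.update p e 0) ends a₁ a₂ b := by
  have h1 : prob (Function.update p e 1) (connEvent ends a₂ b) =
      prob (Function.update p e 1) (connEvent ends a₁ b) := by
    rw [prob_update_one_eq_preimage, prob_update_one_eq_preimage]
    congr 1
    ext ω
    simp only [Set.mem_preimage, connEvent, Set.mem_setOf_eq]
    constructor
    · intro h
      exact conn_trans (conn_roots_update_true he ω) h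
    · intro h
      exact conn_trans (conn_symm (conn_roots_update_true he ω)) h
  unfold gap
  rw [prob_eq_pin p (connEvent ends a₂ b) e, prob_eq_pin p (connEvent ends a₁ b) e, h1]
  ring

/-- `E_Q[σ_b σ_o]` scales. -/
lemma EQbo_rootPair (o b : V) :
    EQbo p ends o a₁ a₂ b = (1 - p e) * EQbo (Function.update p e 0) ends o a₁ a₂ b := by
  simp only [EQbo, prob_Q_inter_rootPair p he]
  ring

/-- `E_Q[σ_b σ₃]` scales. -/
lemma EQb3_rootPair (a₃ b : V) :
    EQb3 p ends a₁ a₂ a₃ b = (1 - p e) * EQb3 (Function.update p e 0) ends a₁ a₂ a₃ b := by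
  simp only [EQb3, prob_T_inter_rootPair p he, prob_T'_inter_rootPair p he]
  ring

/-- `E_Q[σ_b σ₃ 1_{o ∈ U}]` scales. -/
lemma EQb3o_rootPair (o a₃ b : V) :
    EQb3o p ends o a₁ a₂ a₃ b = (1 - p e) * EQb3o (Function.update p e 0) ends o a₁ a₂ a₃ b := by
  simp only [EQb3o, prob_T_inter_rootPair p he, prob_T'_inter_rootPair p he]
  ring

/-- `E_Q[σ_o]` scales. -/
lemma EQo_rootPair (o : V) :
    EQo p ends o a₁ a₂ = (1 - p e) * EQo (Function.update p e 0) ends o a₁ a₂ := by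
  simp only [EQo, prob_Q_inter_rootPair p he]
  ring

/-- `E_Q[σ₃]` scales. -/
lemma EQ3_rootPair (a₃ : V) :
    EQ3 p ends a₁ a₂ a₃ = (1 - p e) * EQ3 (Function.update p e 0) ends a₁ a₂ a₃ := by
  simp only [EQ3, prob_T_rootPair p he, prob_T'_rootPair p he]
  ring

/-- `E_Q[σ₃ 1_{o ∈ U}]` scales. -/
lemma EQ3o_rootPair (o a₃ : V) :
    EQ3o p ends o a₁ a₂ a₃ = (1 - p e) * EQ3o (Function.update p e 0) ends o a₁ a₂ a₃ := by
  simp only [EQ3o, prob_T_inter_rootPair p he, prob_T'_inter_rootPair p he]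
  ring

/-- `P(PD, b ∈ U)` scales. -/
lemma PDb_rootPair (a₃ b : V) :
    PDb p ends a₁ a₂ a₃ b = (1 - p e) * PDb (Function.update p e 0) ends a₁ a₂ a₃ b := by
  simp only [PDb, prob_PD_inter_rootPair p he]
  ring

/-- `P(PD, b ∈ U, o ∈ U)` scales. -/
lemma PDbo_rootPair (o a₃ b : V) :
    PDbo p ends o a₁ a₂ a₃ b = (1 - p e) * PDbo (Function.update p e 0) ends o a₁ a₂ a₃ b := by
  simp only [PDbo, prob_PD_inter_rootPair p he]
  ring

/-- `D_o = P(PD, o ∈ U)` scales. -/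
lemma Do_rootPair (o a₃ : V) :
    Do p ends o a₁ a₂ a₃ = (1 - p e) * Do (Function.update p e 0) ends o a₁ a₂ a₃ := by
  simp only [Do, prob_PD_inter_rootPair p he]
  ring

/-- `D · E_Q[F]` scales by the square. -/
lemma DEF_rootPair (o a₃ : V) :
    DEF p ends o a₁ a₂ a₃ = (1 - p e) ^ 2 * DEF (Function.update p e 0) ends o a₁ a₂ a₃ := by
  simp only [DEF, prob_PD_rootPair p he, EQo_rootPair p he, Do_rootPair p he, EQ3_rootPair p he,
    EQ3o_rootPair p he]
  ring

/-- **THE ROOT-PAIR EDGE SCALES THE COVARIANCE FORM**: `Gc p = (1 − p e)³ · Gc (p[e ↦ 0])` for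
`e = {a₁, a₂}` — every mass of `Gc` is `(1 − p e)` times its value with `e` deleted, and `Gc` is
cubic in the masses. -/
theorem Gc_rootPair (o a₃ b : V) :
    Gc p ends o a₁ a₂ a₃ b = (1 - p e) ^ 3 * Gc (Function.update p e 0) ends o a₁ a₂ a₃ b := by
  simp only [Gc, prob_Q_rootPair p he, prob_PD_rootPair p he, EQbo_rootPair p he, Do_rootPair p he,
    EQb3_rootPair p he, EQb3o_rootPair p he, gap_rootPair p he, DEF_rootPair p he,
    PDb_rootPair p he, PDbo_rootPair p he]
  ring

end Scale

section Closure

variable {V : Type*} {E : Type*} [Fintype E] [DecidableEq E] {R : Type*} [Field R]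
  [LinearOrder R] [IsStrictOrderedRing R]

/-- **The root-pair closure**: (HCOV) at `p[e ↦ 0]` gives (HCOV) at `p` for `e = {a₁, a₂}`. -/
theorem HCov_of_update_zero_of_rootPair (p : E → R) (hp : IsProbVec p) {ends : E → Sym2 V} {e : E}
    {a₁ a₂ : V} (he : ends e = s(a₁, a₂)) (o a₃ b : V)
    (h₀ : HCov (Function.update p e 0) ends o a₁ a₂ a₃ b) : HCov p ends o a₁ a₂ a₃ b := by
  unfold HCov at h₀ ⊢
  rw [Gc_rootPair p he o a₃ b]
  exact mul_nonneg (pow_nonneg (sub_nonneg.2 (hp.le_one e)) 3) h₀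

/-- **The root-pair edge is deleted**: (HCOV) on the graph with `e = {a₁, a₂}` re-routed to a loop
at `a₁` gives (HCOV) on `G` (`Gc_update_zero_eq_loop`). -/
theorem HCov_of_loop_of_rootPair (p : E → R) (hp : IsProbVec p) {ends : E → Sym2 V} {e : E}
    {a₁ a₂ : V} (he : ends e = s(a₁, a₂)) (o a₃ b : V)
    (h : HCov p (Function.update ends e s(a₁, a₁)) o a₁ a₂ a₃ b) : HCov p ends o a₁ a₂ a₃ b := by
  refine HCov_of_update_zero_of_rootPair p hp he o a₃ b ?_
  unfold HCov at h ⊢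
  rw [Gc_update_zero_eq_loop p ends e a₁ o a₁ a₂ a₃ b]
  exact h

end Closure

end RootPair

end Summit.Ventures.PercRepro2
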